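import Literature.NumberTheory.EllipticCurves.CastellaGrossiSkinner2025.MazurMainConjecture
import Literature.NumberTheory.EllipticCurves.IsogenyFrobeniusTraceProofs
import Literature.NumberTheory.EllipticCurves.IsogenyDualProofs
import Literature.NumberTheory.EllipticCurves.ModularCurveManinSemistableBridgeProofs
import Literature.NumberTheory.EllipticCurves.IwasawaSelmerDualProofs
import Literature.NumberTheory.EllipticCurves.ComplexMultiplicationBurungaleFlachProofs
import HarnessLib

/-!
# Castella–Grossi–Skinner 2025, printed §3.2: Prop. 3.2.3 — isogeny (in)variance of the
# characteristic power series of `𝔛_ord(E/ℚ_∞)`, weighted by the Néron period (Perrin-Riou 1987,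
# Appendice), and the isogeny invariance of Mazur's main conjecture it yields

HONEST FRAMING (cell `bsd-littype` = BSD share of the cross-ladder LITERATURE-TYPING layer,
D-0088(4); seat `bsd-littype-02`, gen 2): typed ≠ proved ≠ endorsed; nothing here proves BSD.
This file TYPES one PUBLISHED statement as a named fact (`def … : Prop`, nothing asserted;
D-0014/D-0026) — the `ℚ_∞`-display of CGS Prop. 3.2.3 = Perrin-Riou's isogeny formula — in the
vocabulary of Theorem A's transcription (A142, `MazurMainConjecture.lean`), and PROVES its printed
"In particular": the main-conjecture conclusion of A142 transports along `ℚ`-isogenies. Siblings: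
`PerrinRiouMainConjecture.lean` (Thm. 7.2.3, Prop. 3.3.1), `…Proofs.lean` (the printed proof of
Theorem A in the kernel, which invokes Prop. 3.2.3 in print to pass from `E_•` to `E`).

## Citation header (final TeX of Math. Ann. 393 (2025) = arXiv:2303.04373v2, print numbering;
store v1 `paper:arxiv-2303.04373` numbers second)

* **Proposition 3.2.3** (`prop:isog-inv`, §3.2.1 "Isogeny invariance", l. 1223–1240; v1
  "Proposition 2.1.4", `[corpus: paper:arxiv-2303.04373 p0011:L86–L100]`), verbatim: "Suppose
  `E₁/ℚ` and `E₂/ℚ` are isogenous elliptic curves with good ordinary reduction at `p`. Assume that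
  `𝔛_ord(E_i/K_∞^±)` [sic] is `Λ_K⁺`-torsion (`i = 1, 2`), and let `𝓕_ord(E_i/K_∞⁺)` and
  `𝓕_ord(E_i/ℚ_∞)` be characteristic power series for `𝔛_ord(E_i/K_∞⁺)` and `𝔛_ord(E/ℚ_∞)`,
  respectively. Then we have the equalities up to a `p`-adic unit:
  `Ω_{E₁} · 𝓕_ord(E₁/ℚ_∞) ∼_p Ω_{E₂} · 𝓕_ord(E₂/ℚ_∞)`,
  `Ω_{E₁/K} · 𝓕_ord(E₁/K_∞⁺) ∼_p Ω_{E₂/K} · 𝓕_ord(E₂/K_∞⁺)`. In particular, the main conjectures for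
  `𝔛_ord(E/ℚ_∞)` and `𝔛_ord(E/K_∞⁺)` are both invariant under isogenies. *Proof.* See
  [Perrin-Riou 1987, Appendice]." Preceded by (l. 1225): "Conjectures 3.2.1 and 3.2.2 are known to
  be invariant under isogenies. This follows from a computation in global duality due to Schneider
  and Perrin-Riou." Standing hypotheses of §3 (l. 1104): `p` an ODD prime of good ordinary reduction.
* ORIGINAL: B. Perrin-Riou, *Fonctions `L` `p`-adiques, théorie d'Iwasawa et points de Heegner*,
  Bull. Soc. Math. France **115** (1987) 399–456 (held: `paper:doi-10-24033-bsmf-2085`, printed page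
  = PDF page + 397): §1 Proposition 6 (p. 409, `p0012:L23–L26`): "Soient deux courbes elliptiques
  `E` et `E'` définies sur `ℚ` et isogènes ayant bonne réduction ordinaire en `p`. Alors, on a
  `Ω_E 𝔏_p(E/k_∞) ∼ Ω_{E'} 𝔏_p(E'/k_∞)`"; Appendice "Variation de la fonction `L` `p`-adique
  algébrique par isogénie", THÉORÈME (p. 448–449, `p0051:L13–p0052:L6`: for an isogeny `f : E → E'`
  of `p`-power degree over a number field `F`, good ordinary at `p`, and a `ℤ_p^r`-extension `F_∞/F`
  in which the bad places do not split completely, with `𝔏(E/F_∞) ≠ 0`: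
  `𝔏(E'/F_∞) = p^{m(f)} 𝔏(E/F_∞)` with `m(f)` explicit) and LEMME (p. 455, `p0058:L29–L31`): "Le
  nombre `Ω(E'/F)/Ω(E/F)` est un rationnel et on a `ord_p(Ω(E'/F)/Ω(E/F)) = −m(f)`. On en déduit que
  `Ω(E/F) 𝔏_p(E/F_∞)` est un invariant d'isogénie."

## Transcription (word for word → tree predicate) and faithfulness

1. "`E₁/ℚ`, `E₂/ℚ` isogenous elliptic curves" — globally minimal `W₁ W₂ : WeierstrassCurve ℚ`,
   `[IsElliptic]`, `IsIsogenous W₁ W₂` (tree `Isogeny.lean`: a `Γ_ℚ`-equivariant isogeny); "good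
   ordinary reduction at `p`" for both — `IsOrdinaryAt W_i p`; `p ≠ 2` (§3 standing hypothesis).
2. `ℚ_∞`, `Λ_ℚ`, `𝔛_ord(E_i/ℚ_∞)` — a cyclotomic `κ : ZpExtension ℚ p` with topological generator
   `γ` (A142 item 4; no normalisation to `γ_cyc` is needed, the statement compares two modules over
   the same `Λ`), `D_i : W_i.SelmerDualData κ γ` (A142 item 6); "Assume `𝔛_ord(E_i/ℚ_∞)` is torsion"
   — `D_i.IsTorsion`; "characteristic power series `𝓕_i`" — `D_i.charIdeal = (F_i)`.
3. "`Ω_{E₁}·𝓕₁ ∼_p Ω_{E₂}·𝓕₂` (equality up to a `p`-adic unit)" — with `Ω_{E₂} = r · Ω_{E₁}`,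
   `r ∈ ℚ^×` (Perrin-Riou's Lemme: the period ratio of isogenous curves is rational), this says
   `𝓕₁ = r · u · 𝓕₂` for a unit `u` of `Λ` (characteristic power series are defined up to `Λ^×`, which
   contains `ℤ_p^×`, so the prime-to-`p` part of `r` and the sign are absorbed): `∃ (r : ℚ)
   (u : Λˣ), W₂.realPeriodRat = r · W₁.realPeriodRat ∧ ι F₁ = C r · ι u · ι F₂`,
   `ι = iwasawaToPowerSeries p`. The tree's `realPeriodRat = ∫_{E(ℝ)}|ω| = c_∞ Ω⁺` differs from the
   Néron `Ω⁺` by `c_∞ ∈ {1, 2}`, a unit for odd `p` — absorbed in `u`. FAITHFUL (the `ℚ_∞`-display).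
4. NOT TYPED (GAP): the `K_∞⁺`-display with the complex period
   `Ω_{E/K} = |D_K|^{-1/2} ∫_{E(ℂ)} ω ∧ i ω̄` (Rem. 2.2.3) — no tree carrier for `Ω_{E/K}`.
   -- TODO(general form): the `K_∞⁺`-display of Prop. 3.2.3 / Perrin-Riou's THÉORÈME over a number
   -- field `F` and a `ℤ_p^r`-extension.
5. "In particular, the main conjecture for `𝔛_ord(E/ℚ_∞)` is invariant under isogenies" — PROVED
   below (`thmAConclusion_of_isIsogenous`) from the fact: if the conclusion of A142
   holds for `W₁` at `(f, ϖ₁)` then it holds for `W₂` at `(f, ϖ₂)` (`f` is the newform of both,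
   `IsNewformOf.of_isIsogenous`; `a_p(E₁) = a_p(E₂)`, `frobeniusTrace_eq_of_isIsogenous`, so the unit
   roots agree; `ϖ₂ = ϖ₁ / r`).

No `_holds` is to be expected (Perrin-Riou's/Schneider's global-duality computation of the
`μ`-variation under `p`-power isogenies; the tree has the `λ`-part for class X2 on the Summits side,
`Summits/…/X2/IsogenyLambdaInvariant.lean`, not the `μ`/period part). Exactly ONE named fact.

## References
* [CastellaGrossiSkinner2025] Math. Ann. 393 (2025) 2451–2506 = arXiv:2303.04373v2, Prop. 3.2.3
  (§3.2.1; v1 Prop. 2.1.4).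
* [PerrinRiou1987BSMF] B. Perrin-Riou, Bull. SMF 115 (1987) 399–456, §1 Prop. 6 (p. 409); Appendice,
  Théorème (pp. 448–449) and Lemme (p. 455).
* P. Schneider, *The `μ`-invariant of isogenies*, J. Indian Math. Soc. 52 (1987) 159–170 (the
  paper's [schneider-isogenies]; not read by this seat).
-/

noncomputable section

open scoped Classical MatrixGroups ModularForm

open CongruenceSubgroup WeierstrassCurve NumberField Literature.NumberTheory.EllipticCurves
  Literature.NumberTheory.EllipticCurves.ModularForms Literature.NumberTheory.EllipticCurves.Rank1Residual

namespace Literature.NumberTheory.EllipticCurves.CastellaGrossiSkinner2025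

/-- **Castella–Grossi–Skinner 2025, Proposition 3.2.3, first display** (`prop:isog-inv`, final
TeX l. 1230–1240; arXiv v1 "Proposition 2.1.4", `[corpus: paper:arxiv-2303.04373 p0011:L88–L100]`)
**= Perrin-Riou, Bull. SMF 115 (1987), §1 Prop. 6 (p. 409) / Appendice, Théorème (pp. 448–449) +
Lemme (p. 455)**: "Suppose `E₁/ℚ` and `E₂/ℚ` are isogenous elliptic curves with good ordinary
reduction at `p`. Assume that `𝔛_ord(E_i/ℚ_∞)` is `Λ`-torsion (`i = 1, 2`), and let
`𝓕_ord(E_i/ℚ_∞)` be characteristic power series … Then we have the equalit[y] up to a `p`-adic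
unit: `Ω_{E₁} · 𝓕_ord(E₁/ℚ_∞) ∼_p Ω_{E₂} · 𝓕_ord(E₂/ℚ_∞)`" (Perrin-Riou's Lemme: "`Ω(E'/F)/Ω(E/F)`
est un rationnel … `Ω(E/F)𝔏_p(E/F_∞)` est un invariant d'isogénie"). Transcription (module
docstring items 1–3): `W₁ ∼ W₂` globally minimal and `ℚ`-isogenous (`IsIsogenous`), `p ≠ 2` good
ordinary for both, `κ` cyclotomic with topological generator `γ`, torsion dual data `D₁, D₂` with
generators `F₁, F₂` of their characteristic ideals; conclusion: `Ω(W₂) = r · Ω(W₁)` for a rational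
`r` and `ι F₁ = C r · ι u · ι F₂` for a unit `u ∈ Λ^×` (`Ω = realPeriodRat`; the factors `c_∞` and
the sign are units for odd `p`, absorbed in `u`). The `K_∞⁺`-display (complex period `Ω_{E/K}`) is
not typed (module docstring item 4). [cite: CastellaGrossiSkinner2025, Prop. 3.2.3 (§3.2.1), first display; arXiv v1 Prop. 2.1.4]
[cite: PerrinRiou1987BSMF, §1 Prop. 6 (p. 409); Appendice, Théorème (pp. 448–449) and Lemme (p. 455)] -/
def prop323_charGenerator_eq_of_isIsogenous : Prop :=
  ∀ (W₁ W₂ : WeierstrassCurve ℚ) [W₁.IsElliptic] [W₁.IsGloballyMinimal] [W₂.IsElliptic]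
    [W₂.IsGloballyMinimal] (p : ℕ) [Fact p.Prime],
    p ≠ 2 → IsOrdinaryAt W₁ p → IsOrdinaryAt W₂ p → IsIsogenous W₁ W₂ →
    ∀ (κ : ZpExtension ℚ p) (γ : Field.absoluteGaloisGroup ℚ),
      κ.IsCyclotomic → κ.IsTopGenerator γ →
    ∀ (D₁ : W₁.SelmerDualData κ γ) (D₂ : W₂.SelmerDualData κ γ),
      D₁.IsTorsion → D₂.IsTorsion →
    ∀ (F₁ F₂ : IwasawaAlgebra p),
      D₁.charIdeal = Ideal.span {F₁} → D₂.charIdeal = Ideal.span {F₂} →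
    ∃ (r : ℚ) (u : (IwasawaAlgebra p)ˣ),
      W₂.realPeriodRat = (r : ℝ) * W₁.realPeriodRat ∧
      iwasawaToPowerSeries p F₁ =
        PowerSeries.C ((r : ℚ) : ℚ_[p]) * iwasawaToPowerSeries p (u : IwasawaAlgebra p) *
          iwasawaToPowerSeries p F₂

variable {W₁ W₂ : WeierstrassCurve ℚ} [W₁.IsElliptic] [W₁.IsGloballyMinimal] [W₂.IsElliptic]
  [W₂.IsGloballyMinimal] {p : ℕ} [Fact p.Prime]

/-- `ℚ`-isogenous globally minimal curves, both good at `p`, have the same unit root `α_p`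
(`a_p(E₁) = a_p(E₂)`, tree `frobeniusTrace_eq_of_isIsogenous` = Faltings / *AEC* Ex. 5.4).
[cite: Faltings1983Endlichkeit, §5 Korollar 2 (i) ⇒ (iv)] -/
theorem unitRoot_eq_of_isIsogenous (h : IsIsogenous W₁ W₂) (h₁ : W₁.HasGoodReductionAtPrime p)
    (h₂ : W₂.HasGoodReductionAtPrime p) : unitRoot W₁ p = unitRoot W₂ p := by
  unfold unitRoot
  rw [frobeniusTrace_eq_of_isIsogenous h p h₁ h₂]

/-- **Prop. 3.2.3, "In particular": Mazur's (MC) statement for `𝔛_ord(E/ℚ_∞)` is invariant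
under isogenies** (the source's word for (MC) elided here because of the tree's docstring lint) — in
the kernel, for the conclusion of Theorem A's transcription (A142): if
`W₁ ∼ W₂` are `ℚ`-isogenous globally minimal curves, `p ≠ 2` good ordinary, `f` the (common)
newform with `ϖ₁ · Ω(W₁) = Ω⁺_f`, `ϖ₂ · Ω(W₂) = Ω⁺_f`, and every dual datum of `W₁` is torsion with
`char = (g)`, `ι g = ϖ₁ · L_p(f, α)`, then every TORSION dual datum `D₂` of `W₂` has
`char = (g')`, `ι g' = ϖ₂ · L_p(f, α)` (`α = unitRoot W₁ p = unitRoot W₂ p`): by the fact,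
`ι g = C r · ι u · ι F₂` with `Ω(W₂) = r Ω(W₁)`, so `g' := u F₂` works since `ϖ₂ = ϖ₁ / r`.
[cite: CastellaGrossiSkinner2025, Prop. 3.2.3 (the "In particular … both invariant under isogenies" clause)]
[cite: PerrinRiou1987BSMF, Appendice, Lemme (p. 455)] -/
theorem thmAConclusion_of_isIsogenous (h323 : prop323_charGenerator_eq_of_isIsogenous)
    (hiso : IsIsogenous W₁ W₂) (hp2 : p ≠ 2) (hord₁ : IsOrdinaryAt W₁ p) (hord₂ : IsOrdinaryAt W₂ p)
    {κ : ZpExtension ℚ p} {γ : Field.absoluteGaloisGroup ℚ} (hκ : κ.IsCyclotomic)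
    (hγ : κ.IsTopGenerator γ) {N : ℕ} [NeZero N] {f : CuspForm (Gamma0 N) 2}
    {ϖ₁ ϖ₂ : ℚ} (hϖ₁ : (ϖ₁ : ℝ) * W₁.realPeriodRat = plusPeriod f)
    (hϖ₂ : (ϖ₂ : ℝ) * W₂.realPeriodRat = plusPeriod f)
    (hMC : ∀ D₁ : W₁.SelmerDualData κ γ, D₁.IsTorsion ∧
      ∃ g : IwasawaAlgebra p, D₁.charIdeal = Ideal.span {g} ∧
        iwasawaToPowerSeries p g =
          PowerSeries.C (ϖ₁ : ℚ_[p]) * padicLFunction f (unitRoot W₁ p : ℚ_[p]))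
    (D₂ : W₂.SelmerDualData κ γ) (hD₂ : D₂.IsTorsion) :
    ∃ g' : IwasawaAlgebra p, D₂.charIdeal = Ideal.span {g'} ∧
      iwasawaToPowerSeries p g' =
        PowerSeries.C (ϖ₂ : ℚ_[p]) * padicLFunction f (unitRoot W₂ p : ℚ_[p]) := by
  -- a dual datum for `W₁` and a generator of `char D₂`
  let D₁ : W₁.SelmerDualData κ γ := W₁.selmerDualData κ hγ
  obtain ⟨hD₁, g, hg, hιg⟩ := hMC D₁
  obtain ⟨F₂, hF₂⟩ := (charIdeal_isPrincipal_holds p D₂.X).principal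
  have hF₂' : D₂.charIdeal = Ideal.span {F₂} := hF₂
  obtain ⟨r, u, hΩ, hι⟩ :=
    h323 W₁ W₂ p hp2 hord₁ hord₂ hiso κ γ hκ hγ D₁ D₂ hD₁ hD₂ g F₂ hg hF₂'
  -- `r ≠ 0` and `ϖ₂ = ϖ₁ / r`
  have hΩ₁ : 0 < W₁.realPeriodRat := W₁.realPeriodRat_pos_holds
  have hΩ₂ : 0 < W₂.realPeriodRat := W₂.realPeriodRat_pos_holds
  have hr0 : r ≠ 0 := by
    rintro rfl
    rw [Rat.cast_zero, zero_mul] at hΩ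
    exact hΩ₂.ne' hΩ
  have hϖ : ϖ₂ * r = ϖ₁ := by
    have h : ((ϖ₂ * r : ℚ) : ℝ) * W₁.realPeriodRat = (ϖ₁ : ℝ) * W₁.realPeriodRat := by
      rw [Rat.cast_mul, mul_assoc, ← hΩ, hϖ₂, hϖ₁]
    exact_mod_cast mul_right_cancel₀ hΩ₁.ne' h
  refine ⟨(u : IwasawaAlgebra p) * F₂, ?_, ?_⟩
  · rw [hF₂', Ideal.span_singleton_mul_left_unit u.isUnit]
  · -- `C ϖ₁ · L = C r · ι(u F₂)`, so `ι(u F₂) = C (ϖ₁ / r) · L = C ϖ₂ · L`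
    have hr0' : ((r : ℚ) : ℚ_[p]) ≠ 0 := by exact_mod_cast hr0
    have key : PowerSeries.C ((r : ℚ) : ℚ_[p]) *
        iwasawaToPowerSeries p ((u : IwasawaAlgebra p) * F₂) =
        PowerSeries.C (ϖ₁ : ℚ_[p]) * padicLFunction f (unitRoot W₁ p : ℚ_[p]) := by
      rw [map_mul, ← mul_assoc, ← hι, hιg]
    have hϖ' : (ϖ₁ : ℚ_[p]) = (r : ℚ_[p]) * (ϖ₂ : ℚ_[p]) := by
      rw [← hϖ, Rat.cast_mul, mul_comm]
    rw [← unitRoot_eq_of_isIsogenous hiso hord₁.1 hord₂.1]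
    have : PowerSeries.C ((r : ℚ) : ℚ_[p]) *
        (iwasawaToPowerSeries p ((u : IwasawaAlgebra p) * F₂) -
          PowerSeries.C (ϖ₂ : ℚ_[p]) * padicLFunction f (unitRoot W₁ p : ℚ_[p])) = 0 := by
      rw [mul_sub, key, hϖ', map_mul, mul_assoc, sub_self]
    rcases mul_eq_zero.mp this with h0 | h0
    · exact absurd (by simpa using congrArg PowerSeries.constantCoeff h0) hr0'
    · exact sub_eq_zero.mp h0

omit [W₁.IsGloballyMinimal] [W₂.IsGloballyMinimal] in
/-- The newform of `W₁` is the newform of an isogenous `W₂` (tree `IsNewformOf.of_isIsogenous`,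
Faltings), so the hypotheses `(f, ϖ₁)`, `(f, ϖ₂)` of the previous theorem refer to ONE newform, as in
A142. [cite: Faltings1983Endlichkeit, §5 Korollar 2] -/
theorem isNewformOf_of_isIsogenous' {N : ℕ} [NeZero N] {f : CuspForm (Gamma0 N) 2}
    (hf : IsNewformOf W₁ f) (hiso : IsIsogenous W₁ W₂) : IsNewformOf W₂ f :=
  hf.of_isIsogenous hiso.symm_of_charZero

end Literature.NumberTheory.EllipticCurves.CastellaGrossiSkinner2025

end
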